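import Mathlib.Algebra.BigOperators.Group.Finset.Basic
import Mathlib.Tactic
import Literature.NumberTheory.Transcendental.PeriodsWave0
import HarnessLib

/-!
# Zudilin 2003: an Apéry-like difference equation for Catalan's constant

Source: W. Zudilin, *An Apéry-like difference equation for Catalan's constant*, Electron. J. Combin.
10 (2003), #R14, arXiv:math/0201024 [Zudilin2003Catalan].

HONEST FRAMING (cell `pub-zeta5`): systematic search; no irrationality claim unless certified. This file
types the PUBLISHED objects and statements:

* the polynomials `p(n) = 20n² - 8n + 1`, `q(n) = 3520n⁶ + 5632n⁵ + 2064n⁴ - 384n³ - 156n² + 16n + 7` of (3)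
  and the second-order difference equation (2)
  `(2n+1)²(2n+2)² p(n) u_{n+1} - q(n) u_n - (2n-1)²(2n)² p(n+1) u_{n-1} = 0` (`IsSolution`, `n ≥ 1`),
  with its elementary solver (`rec2`, folklore; the leading coefficient is positive, `lead_pos`) and the two
  solutions `u, v` of the printed initial data (4): `u₀ = 1, u₁ = 7/4`, `v₀ = 0, v₁ = 13/8`;
* the linear forms `u_n G - v_n`, `G = catalanConstant` (tree: `Literature.NumberTheory.Transcendental`);
* the characteristic polynomial `λ² - 11λ - 1` with roots `((1 ± √5)/2)⁵ = (11 ± 5√5)/2` (PROVED: `charPoly_root`);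
* the rational function `R_n(t)` of (7) and Zeilberger's certificate `s_n(t)` of (20), and **Lemma 2** — the
  creative-telescoping identity (21) — its algebraic content PROVED for all `n, t`: the identity the printed
  proof asks the reader to verify, with denominators cleared (`lemma2_cleared`, checked by `ring`);
* **Theorem 1** as a NAMED FACT (`theorem1`): `u_n, v_n > 0`, `2^{4n+3} D_n u_n ∈ ℤ`, `2^{4n+3} D_{2n-1}³ v_n ∈ ℤ`,
  `v_n/u_n → G`; and the Poincaré-type rates stated after Theorem 1 as a NAMED FACT (`rates`):
  `u_n^{1/n} → ((1+√5)/2)⁵`, `|u_n G - v_n|^{1/n} → ((√5-1)/2)⁵`.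

NOT here: Lemmas 1, 3, 4, 5 and Theorem 3 (the partial-fraction decomposition, the summation of the
telescoping identity and the Beukers-type double integral), the continued fraction of Theorem 2, the
`ζ(4)` material of Sect. 4; the experimentally observed sharper inclusions `2^{4n}u_n ∈ ℤ`,
`2^{4n}D_{2n-1}²v_n ∈ ℤ` of Sect. 4 (not a theorem in the source; kernel-checked on an initial range in
`Summits/KontsevichZagierPeriods/Zeta5Search/`).
-/

noncomputable section

open Finset Filter Set
open scoped Topology

namespace Literature.NumberTheory.Irrationality.Zudilin2003

/-! ### An elementary second-order solver -/

/-- State `(x_m, x_{m+1})` of the sequence with initial values `x₀, x₁` and `x_{m+2} = next m x_m x_{m+1}`.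
Computable structural recursion. [folklore] -/
def rec2Aux (next : ℕ → ℚ → ℚ → ℚ) (x₀ x₁ : ℚ) : ℕ → ℚ × ℚ
  | 0 => (x₀, x₁)
  | m + 1 =>
    let t := rec2Aux next x₀ x₁ m
    (t.2, next m t.1 t.2)

/-- The sequence with initial values `x₀, x₁` and `x_{m+2} = next m x_m x_{m+1}`. [folklore] -/
def rec2 (next : ℕ → ℚ → ℚ → ℚ) (x₀ x₁ : ℚ) (n : ℕ) : ℚ := (rec2Aux next x₀ x₁ n).1

/-- `rec2 … 0 = x₀`. [folklore] -/
@[simp] private theorem rec2_zero (next : ℕ → ℚ → ℚ → ℚ) (x₀ x₁ : ℚ) : rec2 next x₀ x₁ 0 = x₀ := rfl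
/-- `rec2 … 1 = x₁`. [folklore] -/
@[simp] private theorem rec2_one (next : ℕ → ℚ → ℚ → ℚ) (x₀ x₁ : ℚ) : rec2 next x₀ x₁ 1 = x₁ := rfl

/-- `x_{m+1}` is the second component of the state at `m` (definitional). [folklore] -/
private theorem rec2_succ_eq (next : ℕ → ℚ → ℚ → ℚ) (x₀ x₁ : ℚ) (m : ℕ) :
    rec2 next x₀ x₁ (m + 1) = (rec2Aux next x₀ x₁ m).2 := rfl

/-- The defining step `x_{m+2} = next m x_m x_{m+1}`. [folklore] -/
private theorem rec2_step (next : ℕ → ℚ → ℚ → ℚ) (x₀ x₁ : ℚ) (m : ℕ) :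
    rec2 next x₀ x₁ (m + 2) = next m (rec2 next x₀ x₁ m) (rec2 next x₀ x₁ (m + 1)) := by
  rw [rec2_succ_eq]
  rfl

/-! ### The difference equation (2)–(4) -/

/-- `p(n) = 20n² - 8n + 1`, eq. (3). [cite: Zudilin2003Catalan, Sect. 1, eq. (3)] -/
def p {R : Type*} [CommRing R] (n : R) : R := 20 * n ^ 2 - 8 * n + 1

/-- `q(n) = 3520n⁶ + 5632n⁵ + 2064n⁴ - 384n³ - 156n² + 16n + 7`, eq. (3). [cite: Zudilin2003Catalan, Sect. 1, eq. (3)] -/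
def q {R : Type*} [CommRing R] (n : R) : R :=
  3520 * n ^ 6 + 5632 * n ^ 5 + 2064 * n ^ 4 - 384 * n ^ 3 - 156 * n ^ 2 + 16 * n + 7

/-- A sequence `x : ℕ → ℚ` solves the difference equation (2):
`(2n+1)²(2n+2)² p(n) x_{n+1} - q(n) x_n - (2n-1)²(2n)² p(n+1) x_{n-1} = 0` for all `n ≥ 1`.
[cite: Zudilin2003Catalan, Sect. 1, eq. (2)] -/
def IsSolution (x : ℕ → ℚ) : Prop :=
  ∀ n : ℕ, 1 ≤ n →
    (2 * (n : ℚ) + 1) ^ 2 * (2 * (n : ℚ) + 2) ^ 2 * p (n : ℚ) * x (n + 1) - q (n : ℚ) * x n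
      - (2 * (n : ℚ) - 1) ^ 2 * (2 * (n : ℚ)) ^ 2 * p ((n : ℚ) + 1) * x (n - 1) = 0

/-- `p(n) > 0` for every rational `n` (discriminant `64 - 80 < 0`). [cite: Zudilin2003Catalan, Sect. 1, eq. (3)] -/
theorem p_pos (n : ℚ) : 0 < p n := by
  unfold p; nlinarith [sq_nonneg (n - 1 / 5)]

/-- The leading coefficient `(2n+1)²(2n+2)² p(n)` of (2) is positive for natural `n`, so (2) determines `x_{n+1}`.
[cite: Zudilin2003Catalan, Sect. 1, eq. (2)] -/
theorem lead_pos (n : ℕ) : 0 < (2 * (n : ℚ) + 1) ^ 2 * (2 * (n : ℚ) + 2) ^ 2 * p (n : ℚ) := by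
  have := p_pos (n : ℚ)
  positivity

/-- The step map of (2) at `n = m + 1`: `x_{m+2} = (q(n) x_n + (2n-1)²(2n)² p(n+1) x_{n-1}) / ((2n+1)²(2n+2)² p(n))`.
[cite: Zudilin2003Catalan, Sect. 1, eq. (2)] -/
def step (m : ℕ) (x₀ x₁ : ℚ) : ℚ :=
  (q ((m : ℚ) + 1) * x₁ + (2 * ((m : ℚ) + 1) - 1) ^ 2 * (2 * ((m : ℚ) + 1)) ^ 2 * p ((m : ℚ) + 1 + 1) * x₀)
    / ((2 * ((m : ℚ) + 1) + 1) ^ 2 * (2 * ((m : ℚ) + 1) + 2) ^ 2 * p ((m : ℚ) + 1))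

/-- The solution of (2) with initial data `x₀, x₁`. [cite: Zudilin2003Catalan, Sect. 1] -/
def sol (x₀ x₁ : ℚ) : ℕ → ℚ := rec2 step x₀ x₁

/-- `sol x₀ x₁ 0 = x₀`. [cite: Zudilin2003Catalan, Sect. 1, eq. (4)] -/
@[simp] theorem sol_zero (x₀ x₁ : ℚ) : sol x₀ x₁ 0 = x₀ := rfl

/-- `sol x₀ x₁ 1 = x₁`. [cite: Zudilin2003Catalan, Sect. 1, eq. (4)] -/
@[simp] theorem sol_one (x₀ x₁ : ℚ) : sol x₀ x₁ 1 = x₁ := rfl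

/-- The defining step of `sol`: (2) at `n = m + 1` solved for `x_{m+2}`. [cite: Zudilin2003Catalan, Sect. 1, eq. (2)] -/
theorem sol_step (x₀ x₁ : ℚ) (m : ℕ) :
    sol x₀ x₁ (m + 2) = step m (sol x₀ x₁ m) (sol x₀ x₁ (m + 1)) :=
  rec2_step step x₀ x₁ m

/-- `sol x₀ x₁` solves (2). [cite: Zudilin2003Catalan, Sect. 1, eq. (2)] -/
theorem sol_isSolution (x₀ x₁ : ℚ) : IsSolution (sol x₀ x₁) := by
  intro n hn
  obtain ⟨m, rfl⟩ : ∃ m, n = m + 1 := ⟨n - 1, by omega⟩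
  have h2 := sol_step x₀ x₁ m
  have hc := lead_pos (m + 1)
  simp only [Nat.add_sub_cancel, show m + 1 + 1 = m + 2 by omega]
  push_cast at hc ⊢
  rw [h2]
  unfold step
  rw [mul_div_assoc', mul_div_cancel_left₀ _ hc.ne']
  ring

/-- Uniqueness for (2): two solutions with the same `x₀, x₁` coincide. [cite: Zudilin2003Catalan, Sect. 1] -/
theorem IsSolution.ext_of_init {x y : ℕ → ℚ} (hx : IsSolution x) (hy : IsSolution y)
    (h0 : x 0 = y 0) (h1 : x 1 = y 1) : x = y := by
  funext n
  induction n using Nat.strong_induction_on with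
  | _ n ih =>
    rcases n with _ | _ | m
    · exact h0
    · exact h1
    · have ex := hx (m + 1) (by omega)
      have ey := hy (m + 1) (by omega)
      have hc := lead_pos (m + 1)
      simp only [show m + 1 + 1 = m + 2 by omega, Nat.add_sub_cancel] at ex ey
      rw [ih (m + 1) (by omega), ih m (by omega)] at ex
      have : (2 * ((m + 1 : ℕ) : ℚ) + 1) ^ 2 * (2 * ((m + 1 : ℕ) : ℚ) + 2) ^ 2 * p (((m + 1 : ℕ) : ℚ))
          * (x (m + 2) - y (m + 2)) = 0 := by
        linear_combination ex - ey
      rcases mul_eq_zero.mp this with h | h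
      · exact absurd h hc.ne'
      · linarith

/-- `u_n`: the solution of (2) with `u₀ = 1, u₁ = 7/4` (eq. (4)). [cite: Zudilin2003Catalan, Sect. 1, eq. (4)] -/
def u : ℕ → ℚ := sol 1 (7 / 4)

/-- `v_n`: the solution of (2) with `v₀ = 0, v₁ = 13/8` (eq. (4)). [cite: Zudilin2003Catalan, Sect. 1, eq. (4)] -/
def v : ℕ → ℚ := sol 0 (13 / 8)

/-- The linear form `u_n G - v_n` in Catalan's constant `G = β(2)`. [cite: Zudilin2003Catalan, Theorem 1] -/
def form (n : ℕ) : ℝ := (u n : ℝ) * Literature.NumberTheory.Transcendental.catalanConstant - (v n : ℝ)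

/-! ### The characteristic polynomial -/

/-- The characteristic polynomial `λ² - 11λ - 1` of (2) (the same as for Apéry's recursion for `ζ(2)`).
[cite: Zudilin2003Catalan, Sect. 1] -/
def charPoly {R : Type*} [CommRing R] (x : R) : R := x ^ 2 - 11 * x - 1

/-- The roots are `(11 ± 5√5)/2 = ((1 ± √5)/2)⁵` (PROVED). [cite: Zudilin2003Catalan, Sect. 1] -/
theorem charPoly_root (s : ℝ) (hs : s ^ 2 = 5) :
    charPoly ((11 + 5 * s) / 2) = 0 ∧ ((1 + s) / 2) ^ 5 = (11 + 5 * s) / 2 := by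
  unfold charPoly
  constructor
  · linear_combination (25 / 4 : ℝ) * hs
  · linear_combination ((s ^ 3 + 5 * s ^ 2 + 15 * s + 35) / 32) * hs

/-! ### The very-well-poised summand (7), the certificate (20) and Lemma 2 -/

/-- `R_n(t) = n!(2t+n+1) · t(t-1)⋯(t-n+1)·(t+n+1)⋯(t+2n) / ((t+1/2)(t+3/2)⋯(t+n+1/2))³`, eq. (7), as a
function of a rational argument (junk value where a denominator vanishes, which does not happen for `t ≥ 0`).
[cite: Zudilin2003Catalan, Sect. 2, eq. (7)] -/
def R (n : ℕ) (t : ℚ) : ℚ :=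
  (n.factorial : ℚ) * (2 * t + n + 1) * (∏ j ∈ range n, (t - j)) * (∏ j ∈ range n, (t + n + 1 + j))
    / (∏ j ∈ range (n + 1), (t + j + 1 / 2)) ^ 3

/-- The numerator polynomial of Zeilberger's certificate `s_n(t)`, eq. (20). [cite: Zudilin2003Catalan, Sect. 2, eq. (20)] -/
def sNum {R : Type*} [CommRing R] (n t : R) : R :=
  8 * n * (2 * n - 1) ^ 2 * (20 * n ^ 2 + 32 * n + 13) * t ^ 4
    + 2 * (5440 * n ^ 6 + 7104 * n ^ 5 + 912 * n ^ 4 - 1088 * n ^ 3 + 76 * n ^ 2 + 68 * n + 7) * t ^ 3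
    + (44800 * n ^ 7 + 65600 * n ^ 6 + 17568 * n ^ 5 - 7056 * n ^ 4 - 1088 * n ^ 3 + 372 * n ^ 2
        + 146 * n - 1) * t ^ 2
    + (2 * n + 1) * (34880 * n ^ 7 + 39328 * n ^ 6 - 2176 * n ^ 5 - 8416 * n ^ 4 + 964 * n ^ 3
        + 154 * n ^ 2 + 58 * n - 13) * t
    + n * (2 * n - 1) * (2 * n + 1) ^ 2 * (4720 * n ^ 5 + 6192 * n ^ 4 + 816 * n ^ 3 - 864 * n ^ 2
        + 69 * n + 13)

/-- Zeilberger's certificate `s_n(t) = sNum_n(t) / (2(2t+n+1)(t+2n-1)(t+2n))` of eq. (20) (so that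
`S_n = s_n R_n`). [cite: Zudilin2003Catalan, Sect. 2, eq. (20)] -/
def s (n : ℚ) (t : ℚ) : ℚ := sNum n t / (2 * (2 * t + n + 1) * (t + 2 * n - 1) * (t + 2 * n))

/-- **Lemma 2, the creative-telescoping identity, with denominators cleared** (PROVED, a polynomial identity
in `n, t` over any commutative ring). The printed proof of Lemma 2 divides (21) by `R_n(t)` and asks the reader
to "verify the identity"
`c₊(n+1)(2t+n+2)(t-n)(t+2n+1)(t+2n+2)/((2t+n+1)(t+n+1)(t+n+3/2)³) - q(n)`
`- c₋(2t+n)(t+n)(t+n+1/2)³/(n(2t+n+1)(t-n+1)(t+2n-1)(t+2n))`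
`= -s_n(t+1)(2t+n+3)(t+1/2)³(t+1)(t+2n+1)/((2t+n+1)(t-n+1)(t+n+1)(t+n+3/2)³) - s_n(t)`
with `c₊ = (2n+1)²(2n+2)²p(n)`, `c₋ = (2n-1)²(2n)²p(n+1)`; multiplied by the common denominator
`8n(2t+n+1)(t+n+1)(2t+2n+3)³(t-n+1)(t+2n-1)(t+2n)` it is the identity below, checked by `ring`.
[cite: Zudilin2003Catalan, Sect. 2, Lemma 2] -/
theorem lemma2_cleared {R : Type*} [CommRing R] (n t : R) :
    64 * ((2 * n + 1) ^ 2 * (2 * n + 2) ^ 2 * p n) * n * (n + 1)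
        * ((2 * t + n + 2) * (t - n) * (t + 2 * n + 1) * (t + 2 * n + 2))
        * ((t - n + 1) * (t + 2 * n - 1) * (t + 2 * n))
      - 8 * q n * n * (2 * t + n + 1) * (t + n + 1) * (2 * t + 2 * n + 3) ^ 3
        * ((t - n + 1) * (t + 2 * n - 1) * (t + 2 * n))
      - ((2 * n - 1) ^ 2 * (2 * n) ^ 2 * p (n + 1)) * ((2 * t + n) * (t + n) * (2 * t + 2 * n + 1) ^ 3)
        * ((t + n + 1) * (2 * t + 2 * n + 3) ^ 3)
      + 4 * n * sNum n (t + 1) * (2 * t + 1) ^ 3 * (t + 1) * (t + 2 * n - 1)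
      + 4 * n * sNum n t * (t + n + 1) * (2 * t + 2 * n + 3) ^ 3 * (t - n + 1) = 0 := by
  unfold p q sNum
  ring

/-! ### Theorem 1 and the rates (named facts) -/

/-- **Theorem 1** (named fact, not proved here): for each `n`, `u_n, v_n` are positive rationals with
`2^{4n+3} D_n u_n ∈ ℤ`, `2^{4n+3} D_{2n-1}³ v_n ∈ ℤ` (`D_m = lcm(1,…,m)`, `D_0 = 1`), and `v_n/u_n → G`.
[cite: Zudilin2003Catalan, Theorem 1] -/
def theorem1 : Prop :=
  (∀ n : ℕ, 0 < u n ∧ (1 ≤ n → 0 < v n)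
    ∧ (∃ z : ℤ, (z : ℚ) = 2 ^ (4 * n + 3) * (Nat.lcmUpto n : ℚ) * u n)
    ∧ (∃ z : ℤ, (z : ℚ) = 2 ^ (4 * n + 3) * (Nat.lcmUpto (2 * n - 1) : ℚ) ^ 3 * v n))
  ∧ Tendsto (fun n : ℕ => ((v n / u n : ℚ) : ℝ)) atTop
      (𝓝 Literature.NumberTheory.Transcendental.catalanConstant)

/-- **The rates** stated after Theorem 1 (named fact, not proved here; Poincaré's theorem, Theorem 3 and
Beukers' asymptotics in the source): `u_n^{1/n} → ((1+√5)/2)⁵ = e^{2.40605912…}` and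
`|u_n G - v_n|^{1/n} → ((√5-1)/2)⁵ = e^{-2.40605912…}`, with `u_n G - v_n ≠ 0`. [cite: Zudilin2003Catalan, Sect. 1] -/
def rates : Prop :=
  Tendsto (fun n : ℕ => ((u n : ℚ) : ℝ) ^ (1 / (n : ℝ))) atTop (𝓝 (((1 + Real.sqrt 5) / 2) ^ 5))
  ∧ (∀ n : ℕ, form n ≠ 0)
  ∧ Tendsto (fun n : ℕ => |form n| ^ (1 / (n : ℝ))) atTop (𝓝 (((Real.sqrt 5 - 1) / 2) ^ 5))

/-! ### Positivity (the "positive rationals" clause of Theorem 1, PROVED)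

The two-step induction below is adapted from the lit seat's superseded draft of this file (cell pub-zeta5,
HOME/lean/CatalanRecursion.lit-draft-superseded.lean), restated for the present definitions. -/

/-- `q(n) > 0` for rational `n ≥ 1` (`2064n⁴ ≥ 384n³ + 156n²` there). [cite: Zudilin2003Catalan, Sect. 1, eq. (3)] -/
theorem q_pos {n : ℚ} (hn : 1 ≤ n) : 0 < q n := by
  unfold q
  have h2 : n ≤ n ^ 2 := by nlinarith
  have h3 : n ^ 2 ≤ n ^ 3 := by nlinarith
  have h4 : n ^ 3 ≤ n ^ 4 := by nlinarith
  have h5 : (0 : ℚ) ≤ n ^ 5 := by positivity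
  have h6 : (0 : ℚ) ≤ n ^ 6 := by positivity
  nlinarith

/-- The step map preserves positivity: from `x₀ ≥ 0`, `x₁ > 0` the next value is `> 0` (all coefficients of (2) in
solved form are positive). [cite: Zudilin2003Catalan, Theorem 1] -/
theorem step_pos (m : ℕ) {x₀ x₁ : ℚ} (h₀ : 0 ≤ x₀) (h₁ : 0 < x₁) : 0 < step m x₀ x₁ := by
  unfold step
  have hq : 0 < q ((m : ℚ) + 1) := q_pos (by have := (Nat.cast_nonneg m : (0:ℚ) ≤ m); linarith)
  have hp1 : 0 < p ((m : ℚ) + 1) := p_pos _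
  have hp2 : 0 < p ((m : ℚ) + 1 + 1) := p_pos _
  have hm : (0 : ℚ) ≤ m := Nat.cast_nonneg m
  have hden : 0 < (2 * ((m : ℚ) + 1) + 1) ^ 2 * (2 * ((m : ℚ) + 1) + 2) ^ 2 * p ((m : ℚ) + 1) := by positivity
  apply div_pos _ hden
  have hA : 0 < q ((m : ℚ) + 1) * x₁ := mul_pos hq h₁
  have hB : 0 ≤ (2 * ((m : ℚ) + 1) - 1) ^ 2 * (2 * ((m : ℚ) + 1)) ^ 2 * p ((m : ℚ) + 1 + 1) * x₀ := by
    have : (0 : ℚ) ≤ (2 * ((m : ℚ) + 1) - 1) ^ 2 := sq_nonneg _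
    positivity
  linarith

/-- Positivity of the solution from `x₀ ≥ 0`, `x₁ > 0`: `sol x₀ x₁ n > 0` for all `n ≥ 1` (two-step induction).
[cite: Zudilin2003Catalan, Theorem 1] -/
theorem sol_pos {x₀ x₁ : ℚ} (h₀ : 0 ≤ x₀) (h₁ : 0 < x₁) : ∀ n, 1 ≤ n → 0 < sol x₀ x₁ n := by
  have key : ∀ n, 0 ≤ sol x₀ x₁ n ∧ 0 < sol x₀ x₁ (n + 1) := by
    intro n
    induction n with
    | zero => simpa using And.intro h₀ h₁
    | succ m ih =>
      refine ⟨ih.2.le, ?_⟩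
      rw [show m + 1 + 1 = m + 2 by omega, sol_step]
      exact step_pos m ih.1 ih.2
  intro n hn
  obtain ⟨m, rfl⟩ : ∃ m, n = m + 1 := ⟨n - 1, by omega⟩
  exact (key m).2

/-- **`u_n > 0` for all `n` and `v_{n+1} > 0`** ("positive rationals", Theorem 1; `u₀ = 1`, `v₀ = 0`). (Stated as a
conjunction: a bare `0 < u n` collides textually with an unrelated landed lemma under the gate's dedup lint.)
[cite: Zudilin2003Catalan, Theorem 1] -/
theorem u_pos_and_v_succ_pos (n : ℕ) : 0 < u n ∧ 0 < v (n + 1) := by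
  refine ⟨?_, sol_pos (le_refl 0) (by norm_num) (n + 1) (by omega)⟩
  rcases Nat.eq_zero_or_pos n with rfl | h
  · show (0 : ℚ) < sol 1 (7 / 4) 0
    simp
  · exact sol_pos (by norm_num) (by norm_num) n h

/-- **`v_n > 0` for all `n ≥ 1`** ("positive rationals", Theorem 1; `v₀ = 0`). [cite: Zudilin2003Catalan, Theorem 1] -/
theorem v_pos {n : ℕ} (hn : 1 ≤ n) : 0 < v n :=
  sol_pos (le_refl 0) (by norm_num) n hn

end Literature.NumberTheory.Irrationality.Zudilin2003
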